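import Literature.MathematicalPhysics.QuantumFieldTheory.Balaban1983to89.B6SectACriticalPointV1

/-!
# `Balaban1983to89.B6SectAScalarModelV1` — T. Bałaban, *Propagators and renormalization transformations for lattice gauge
# theories. II*, Commun. Math. Phys. **96** (1984) 223–250 [Balaban1984PropagatorsII], Sect. A p. 225 ON THE V1
# MULTI-LEVEL TORUS CALCULUS, THE SCALAR SIDE, file 1/2: **`Δ′_a = Δ + Q′*aQ′` (2.13) is positive definite**, ***"The
# operator `G′ = Δ′_a⁻¹` is a well defined, positive operator … This implies that `G′²` and `Q′G′²Q′*` are positive operators,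
# hence `(Q′G′²Q′*)⁻¹` is well defined and positive also"*** — `G′` and `(Q′G′²Q′*)⁻¹` CONSTRUCTED for the CONCRETE multi-level
# operators of `…B6SectAOperatorsV1`, every nested family of domains, every lattice factor `c ≠ 0`, every weight `a > 0`
# (file 2/2 `…B6Eq217ScalarModelV1`: the Lagrange chain (2.15)–(2.16), (2.17) `R = I − G′Q′*(Q′G′²Q′*)⁻¹Q′G′` for gen 5's
# orthogonal projection `R`, (2.13), (2.26)–(2.27))

statement-level skeleton of published theorems with citation tags; proofs where landed; nothing here is a claim about the
Yang–Mills mass gap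

PDF held: `paper:balaban1984-cmp96-propagators-rt-ii` (journal page = PDF page + 222); p. 225 read AS IMAGE on the ×2 render
`run/shared/lean/pub/pub-balaban/b2b-balaban-ref1/pages/1984-cmp96-propagators-rt-II/…-p003-x2.png` (this seat, 2026-08-21).

CITATION HEADER (lean-in-tree rule).  Cell `lit-balaban` (HOME `run/shared/lean/pub/lit-balaban/`), PHASE-2 proof seat **p21**
(gen 6), B6 fold owner r03, referee ref-4.  Files 1–2 COMPLETE the concrete V1 model of Sect. A begun by this seat in gen 5
(`…B6SectADomainsV1` (2.1)–(2.7), `…B6SectAZeroModesV1` (2.11) qualitative, `…B6SectAOntoV1` `Q`/`Q′` onto,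
`…B6SectAOperatorsV1` the operators and `R`, `…B6SectAVectorModelV1` `Δ_a > 0`/`G`/`(QGQ*)⁻¹`, `…B6SectACriticalPointV1`
(2.31)/(2.34)/(2.35)): there the VECTOR side (2.18)–(2.35) was proved; files 1–2 do the SCALAR side (2.13)–(2.17).  WHAT IS
REPRODUCED HERE: SKELETON rows **B6.Eq2.13** ((2.13)–(2.14): `Δ′_a`, its form, *"G′ = Δ′_a⁻¹ is a well defined, positive
operator"*) and the well-definedness sentence of **B6.Eq2.17** (`(Q′G′²Q′*)⁻¹` *"is well defined and positive also"*) — KIND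
model instance (the companion on r03's `…B6Eq211.BlockSystem` carrier is this seat's gen-2 `…B6SectABlockSystem.green` /
`…B6Eq217BlockSystem.cOp`).  Inputs BY NAME: gen 5's `…B6SectAZeroModesV1.eq_zero_of_inGauge_of_laplace_eq_zero` ((2.11)
qualitative), `…B6SectACriticalPointV1.QpsE_injective` (`Q′` onto ⇒ `Q′*` injective), `…B6SectAOperatorsV1.{onE, diagFn,
lapE, QpE, QpsE, inner_lapE_right, inner_QpsE_left, mem_ker_QpE_iff, ofLp_lapE, ofLp_dE}`, r03's `…B6SectA.deltaPrime` (the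
abstract (2.13), instantiated — not restated); Mathlib's `LinearEquiv.ofInjectiveEndo`.

PRINT (p. 225, verbatim).  *"According to the definition a value Rf of the operator R acting on a function f defined on T_η is
equal to Δλ, where λ is a minimum of the functional λ ∈ N(Q′), λ → Σ_x η^d|f(x) − (Δλ)(x)|² = Σ_x η^d|f(x) − (Δ′_aλ)(x)|², (2.13)
and where Δ′_a = Δ + Q′*aQ′ and the operator Q′*aQ′ is given by the quadratic form ⟨λ, Q′*aQ′λ⟩ = Σ_{j=0}^k Σ_{y∈Λ_j}
a_j(L^jη)^{d−2}|(Q′_jλ)(y)|². (2.14) The numbers a_j satisfy the recursive equations a_{j+1} = aa_j/aL⁻² + a_j, a₁ = a (see [1,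
2.13 and 2.15]), and we assume that (Q′₀λ)(x) = λ(x), x ∈ Λ₀. … The operator G′ = Δ′_a⁻¹ is a well defined, positive operator
because Δ′_a satisfies the inequality (2.11) for all λ, with min{a_j, π²} instead of π² and the index j running from 0 to k on the
right-hand side. This implies that G′² and Q′G′²Q′* are positive operators, hence (Q′G′²Q′*)⁻¹ is well defined and positive
also."*

WHAT IS PROVED (0 sorry, 0 new named facts; axioms standard; every nested family `D : Domains P`, lattice factor `c ≠ 0`,
weights `w > 0` on the site index set `𝔅` — printed: `w = a_j(L^jη)^{d−2}` on `Λ_j`; ℓ² pairings as in gen 5, the common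
volume factor `η^d` dropped, which changes no operator identity of Sect. A; the printed weighted adjoint is handled as in
`…B6Eq217BlockSystem` §2).  §1 `Δ` symmetric (`inner_lapE_left`), (2.11) read on `L²(T_η)` (`eq_zero_of_mem_ker_of_lapE_eq_zero`),
the weight `a` (`apE`), **(2.13) `Δ′_a`** = `B6SectA.deltaPrime` at the concrete operators (`deltaPE`, `rfl`), **(2.14)** the form
of `Q′*aQ′` (`inner_QpsaQp_self`) and `⟨λ, Δ′_aλ⟩ = ‖∂λ‖² + Σ_𝔅 w|Q′λ|²` (`inner_deltaPE_self`), symmetry, and **positivity**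
`deltaPE_pos` (the qualitative content of *"Δ′_a satisfies the inequality (2.11) … with the index j running from 0 to k"*: the
two squares vanish only if `∂λ = 0` and `Q′λ = 0` on `𝔅`, and then `λ = 0` by gen 5's (2.11)); **`G′ = Δ′_a⁻¹`** (`GpE`,
two-sided inverse `GpE_comp_deltaPE`/`deltaPE_comp_GpE`, symmetric `inner_GpE_left`, *"a well defined, positive operator"*
`inner_GpE_pos`, injective).  §2 *"G′² and Q′G′²Q′* are positive operators"* (`inner_GpE_sq_pos`, `inner_qggqpE_pos`;
`⟨ω, Q′G′²Q′*ω⟩ = ‖G′Q′*ω‖²`), **`(Q′G′²Q′*)⁻¹`** (`CpE`, two-sided inverse `qggqpE_comp_CpE`/`CpE_comp_qggqpE` = the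
hypotheses `hE1`/`hE2` of `…B6SectA`, symmetric `inner_CpE_left`, *"positive also"* `inner_CpE_pos`).
-/

open scoped InnerProductSpace

namespace Literature.MathematicalPhysics.QuantumFieldTheory.Balaban1983to89.B6SectAScalarModelV1

open LatticeFieldCalculus B6SectADomainsV1 B6SectAZeroModesV1 B6SectAOntoV1 B6SectAOperatorsV1 B6SectAVectorModelV1
  B6SectACriticalPointV1
open BalabanImbrieJaffe1984to88.BIJ85AxialPropagator411 (BondSpace PlaqSpace)

noncomputable section

variable {P : Params} (D : Domains P)

/-! ## §1. `Δ′_a = Δ + Q′*aQ′` (2.13)–(2.14), its positivity, and `G′ = Δ′_a⁻¹` -/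

/-- `Δ = ∂*∂` is symmetric on `L²(T_η)`. [cite: Balaban1984PropagatorsII, (2.8) p.224 + (2.13) p.225] -/
theorem inner_lapE_left (c : ℝ) (f g : ScalarSpace P) : ⟪lapE c f, g⟫_ℝ = ⟪f, lapE c g⟫_ℝ := by
  rw [real_inner_comm, inner_lapE_right, inner_lapE_right, real_inner_comm]

/-- **(2.11), qualitative, read on `L²(T_η)`**: *"the Laplace operator Δ is positive on the subspace N(Q′), hence it is
invertible on this subspace"* — `λ ∈ N(Q′)`, `Δλ = 0` ⇒ `λ = 0` (gen 5's `eq_zero_of_inGauge_of_laplace_eq_zero`).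
[cite: Balaban1984PropagatorsII, (2.11) p.225] -/
theorem eq_zero_of_mem_ker_of_lapE_eq_zero {c : ℝ} (hc : c ≠ 0) (n : ScalarSpace P)
    (hn : n ∈ B6SectA.gaugeSpace (QpE D)) (h0 : lapE c n = 0) : n = 0 := by
  have hΔ : laplace c (WithLp.ofLp n) = 0 := by rw [← ofLp_lapE, h0, WithLp.ofLp_zero]
  exact (WithLp.ofLp_eq_zero (p := 2)).mp
    (eq_zero_of_inGauge_of_laplace_eq_zero D hc ((mem_ker_QpE_iff D n).mp hn) hΔ)

/-- **the weight `a` on `L²(𝔅)` (sites)**: the multiplication operator by `w` (printed: `a_j(L^jη)^{d−2}` on `Λ_j`, (2.14)).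
[cite: Balaban1984PropagatorsII, (2.14) p.225] -/
def apE (w : SiteIdx D → ℝ) : SiteIdxSpace D →ₗ[ℝ] SiteIdxSpace D := onE (diagFn w)

/-- `(aω)(y) = w(y)ω(y)`. [cite: Balaban1984PropagatorsII, (2.14) p.225] -/
@[simp] theorem apE_apply (w : SiteIdx D → ℝ) (ω : SiteIdxSpace D) (i : SiteIdx D) : apE D w ω i = w i * ω i := rfl

/-- `a` is symmetric. [cite: Balaban1984PropagatorsII, (2.14) p.225] -/
theorem inner_apE_left (w : SiteIdx D → ℝ) (ω ω' : SiteIdxSpace D) : ⟪apE D w ω, ω'⟫_ℝ = ⟪ω, apE D w ω'⟫_ℝ := by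
  rw [inner_eq_sum, inner_eq_sum]
  exact Finset.sum_congr rfl fun i _ => by rw [apE_apply, apE_apply]; ring

/-- **(2.13) `Δ′_a = Δ + Q′*aQ′`** for the concrete multi-level operators: r03's `B6SectA.deltaPrime` AT `Δ = lapE`, `Q′ = QpE`,
`Q′* = QpsE`, `a = apE`. [cite: Balaban1984PropagatorsII, (2.13) p.225] -/
def deltaPE (c : ℝ) (w : SiteIdx D → ℝ) : ScalarSpace P →ₗ[ℝ] ScalarSpace P :=
  B6SectA.deltaPrime (lapE c) (QpE D) (QpsE D) (apE D w)

/-- unfolding of (2.13): `Δ′_a = Δ + Q′*aQ′`. [cite: Balaban1984PropagatorsII, (2.13) p.225] -/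
theorem deltaPE_def (c : ℝ) (w : SiteIdx D → ℝ) : deltaPE D c w = lapE c + QpsE D ∘ₗ apE D w ∘ₗ QpE D := rfl

/-- componentwise: `Δ′_aλ = Δλ + Q′*aQ′λ`. [cite: Balaban1984PropagatorsII, (2.13) p.225] -/
theorem deltaPE_apply (c : ℝ) (w : SiteIdx D → ℝ) (f : ScalarSpace P) :
    deltaPE D c w f = lapE c f + QpsE D (apE D w (QpE D f)) := rfl

/-- **(2.14), the form of `Q′*aQ′`**: `⟨λ, Q′*aQ′λ⟩ = Σ_{y ∈ 𝔅} w(y)|(Q′λ)(y)|²` (printed `Σ_{j=0}^k Σ_{y∈Λ_j} a_j(L^jη)^{d−2}|(Q′_jλ)(y)|²`).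
[cite: Balaban1984PropagatorsII, (2.14) p.225] -/
theorem inner_QpsaQp_self (w : SiteIdx D → ℝ) (f : ScalarSpace P) :
    ⟪f, QpsE D (apE D w (QpE D f))⟫_ℝ = ∑ i, w i * QpE D f i ^ 2 := by
  rw [real_inner_comm, inner_QpsE_left, inner_eq_sum]
  exact Finset.sum_congr rfl fun i _ => by rw [apE_apply]; ring

/-- the bilinear form of (2.13): `⟨μ, Δ′_aλ⟩ = ⟨∂μ, ∂λ⟩ + ⟨Q′μ, aQ′λ⟩`. [cite: Balaban1984PropagatorsII, (2.13)–(2.14) p.225] -/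
theorem inner_deltaPE_right (c : ℝ) (w : SiteIdx D → ℝ) (f g : ScalarSpace P) :
    ⟪f, deltaPE D c w g⟫_ℝ = ⟪dE c f, dE c g⟫_ℝ + ⟪QpE D f, apE D w (QpE D g)⟫_ℝ := by
  rw [deltaPE_apply, inner_add_right, inner_lapE_right, real_inner_comm (QpsE D _) f, inner_QpsE_left,
    real_inner_comm (QpE D f) (apE D w (QpE D g))]

/-- `Δ′_a` is symmetric. [cite: Balaban1984PropagatorsII, (2.13) p.225] -/
theorem inner_deltaPE_left (c : ℝ) (w : SiteIdx D → ℝ) (f g : ScalarSpace P) :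
    ⟪deltaPE D c w f, g⟫_ℝ = ⟪f, deltaPE D c w g⟫_ℝ := by
  rw [real_inner_comm, inner_deltaPE_right, inner_deltaPE_right, real_inner_comm (dE c f), ← inner_apE_left,
    real_inner_comm (QpE D f)]

/-- **(2.13)–(2.14): `⟨λ, Δ′_aλ⟩ = ‖∂λ‖² + Σ_{y ∈ 𝔅} w(y)|(Q′λ)(y)|²`**. [cite: Balaban1984PropagatorsII, (2.13)–(2.14) p.225] -/
theorem inner_deltaPE_self (c : ℝ) (w : SiteIdx D → ℝ) (f : ScalarSpace P) :
    ⟪f, deltaPE D c w f⟫_ℝ = ‖dE c f‖ ^ 2 + ∑ i, w i * QpE D f i ^ 2 := by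
  rw [deltaPE_apply, inner_add_right, inner_lapE_right, real_inner_self_eq_norm_sq, inner_QpsaQp_self]

/-- `⟨λ, Δ′_aλ⟩ ≥ 0` for `w ≥ 0`. [cite: Balaban1984PropagatorsII, (2.13) p.225] -/
theorem inner_deltaPE_self_nonneg (c : ℝ) {w : SiteIdx D → ℝ} (hw : ∀ i, 0 ≤ w i) (f : ScalarSpace P) :
    0 ≤ ⟪f, deltaPE D c w f⟫_ℝ := by
  rw [inner_deltaPE_self]
  exact add_nonneg (sq_nonneg _) (Finset.sum_nonneg fun i _ => mul_nonneg (hw i) (sq_nonneg _))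

/-- **The kernel of `Δ′_a` is trivial**: `⟨λ, Δ′_aλ⟩ = 0` forces `∂λ = 0` and `Q′λ = 0` on `𝔅` (so `λ ∈ N(Q′)` with `Δλ = 0`),
hence `λ = 0` by gen 5's (2.11) (*"Δ′_a satisfies the inequality (2.11) for all λ … the index j running from 0 to k"* — the
qualitative content). [cite: Balaban1984PropagatorsII, (2.11) + (2.17) p.225] -/
theorem eq_zero_of_inner_deltaPE_self_eq_zero {c : ℝ} (hc : c ≠ 0) {w : SiteIdx D → ℝ} (hw : ∀ i, 0 < w i)
    {f : ScalarSpace P} (h : ⟪f, deltaPE D c w f⟫_ℝ = 0) : f = 0 := by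
  rw [inner_deltaPE_self] at h
  have hs : 0 ≤ ∑ i, w i * QpE D f i ^ 2 := Finset.sum_nonneg fun i _ => mul_nonneg (hw i).le (sq_nonneg _)
  have h1 : ‖dE c f‖ ^ 2 = 0 := by nlinarith [sq_nonneg ‖dE c f‖]
  have h2 : ∑ i, w i * QpE D f i ^ 2 = 0 := by nlinarith [sq_nonneg ‖dE c f‖]
  have h1' : dE c f = 0 := norm_eq_zero.mp (pow_eq_zero_iff two_ne_zero |>.mp h1)
  have hQ : QpE D f = 0 := PiLp.ext fun i => by
    have hi := (Finset.sum_eq_zero_iff_of_nonneg fun i _ => mul_nonneg (hw i).le (sq_nonneg _)).mp h2 i (Finset.mem_univ i)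
    simpa [(hw i).ne'] using hi
  have hgauge : D.InGauge (WithLp.ofLp f) := (mem_ker_QpE_iff D f).mp (LinearMap.mem_ker.mpr hQ)
  have hΔ : laplace c (WithLp.ofLp f) = 0 := by
    rw [← ofLp_lapE, lapE, LinearMap.comp_apply, h1', map_zero, WithLp.ofLp_zero]
  exact (WithLp.ofLp_eq_zero (p := 2)).mp (eq_zero_of_inGauge_of_laplace_eq_zero D hc hgauge hΔ)

/-- **`Δ′_a` IS POSITIVE DEFINITE**: `⟨λ, Δ′_aλ⟩ > 0` for `λ ≠ 0` (lattice factor `c ≠ 0`, weights `w > 0`).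
[cite: Balaban1984PropagatorsII, (2.17) p.225] -/
theorem deltaPE_pos {c : ℝ} (hc : c ≠ 0) {w : SiteIdx D → ℝ} (hw : ∀ i, 0 < w i) {f : ScalarSpace P} (hf : f ≠ 0) :
    0 < ⟪f, deltaPE D c w f⟫_ℝ :=
  (inner_deltaPE_self_nonneg D c (fun i => (hw i).le) f).lt_of_ne fun h =>
    hf (eq_zero_of_inner_deltaPE_self_eq_zero D hc hw h.symm)

/-- `Δ′_a` is injective … [cite: Balaban1984PropagatorsII, (2.17) p.225] -/
theorem deltaPE_injective {c : ℝ} (hc : c ≠ 0) {w : SiteIdx D → ℝ} (hw : ∀ i, 0 < w i) :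
    Function.Injective (deltaPE D c w) :=
  (injective_iff_map_eq_zero _).mpr fun f hf =>
    eq_zero_of_inner_deltaPE_self_eq_zero D hc hw (by rw [hf, inner_zero_right])

/-- … hence bijective (finite dimension). [cite: Balaban1984PropagatorsII, (2.17) p.225] -/
theorem deltaPE_bijective {c : ℝ} (hc : c ≠ 0) {w : SiteIdx D → ℝ} (hw : ∀ i, 0 < w i) :
    Function.Bijective (deltaPE D c w) :=
  ⟨deltaPE_injective D hc hw, LinearMap.injective_iff_surjective.mp (deltaPE_injective D hc hw)⟩

/-- **`G′ = Δ′_a⁻¹`** (*"The operator G′ = Δ′_a⁻¹ is a well defined, positive operator"*). [cite: Balaban1984PropagatorsII, (2.16)–(2.17) p.225] -/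
def GpE {c : ℝ} (hc : c ≠ 0) {w : SiteIdx D → ℝ} (hw : ∀ i, 0 < w i) : ScalarSpace P →ₗ[ℝ] ScalarSpace P :=
  ((LinearEquiv.ofInjectiveEndo (deltaPE D c w) (deltaPE_injective D hc hw)).symm : ScalarSpace P →ₗ[ℝ] ScalarSpace P)

/-- `G′Δ′_a = 1`. [cite: Balaban1984PropagatorsII, (2.17) p.225] -/
theorem GpE_comp_deltaPE {c : ℝ} (hc : c ≠ 0) {w : SiteIdx D → ℝ} (hw : ∀ i, 0 < w i) :
    GpE D hc hw ∘ₗ deltaPE D c w = LinearMap.id := by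
  have h := LinearEquiv.ofInjectiveEndo_left_inv (deltaPE D c w) (deltaPE_injective D hc hw)
  rwa [Module.End.mul_eq_comp, Module.End.one_eq_id] at h

/-- `Δ′_aG′ = 1`. [cite: Balaban1984PropagatorsII, (2.17) p.225] -/
theorem deltaPE_comp_GpE {c : ℝ} (hc : c ≠ 0) {w : SiteIdx D → ℝ} (hw : ∀ i, 0 < w i) :
    deltaPE D c w ∘ₗ GpE D hc hw = LinearMap.id := by
  have h := LinearEquiv.ofInjectiveEndo_right_inv (deltaPE D c w) (deltaPE_injective D hc hw)
  rwa [Module.End.mul_eq_comp, Module.End.one_eq_id] at h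

/-- `G′(Δ′_aλ) = λ`. [cite: Balaban1984PropagatorsII, (2.17) p.225] -/
@[simp] theorem GpE_deltaPE {c : ℝ} (hc : c ≠ 0) {w : SiteIdx D → ℝ} (hw : ∀ i, 0 < w i) (f : ScalarSpace P) :
    GpE D hc hw (deltaPE D c w f) = f :=
  LinearMap.congr_fun (GpE_comp_deltaPE D hc hw) f

/-- `Δ′_a(G′f) = f`. [cite: Balaban1984PropagatorsII, (2.17) p.225] -/
@[simp] theorem deltaPE_GpE {c : ℝ} (hc : c ≠ 0) {w : SiteIdx D → ℝ} (hw : ∀ i, 0 < w i) (f : ScalarSpace P) :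
    deltaPE D c w (GpE D hc hw f) = f :=
  LinearMap.congr_fun (deltaPE_comp_GpE D hc hw) f

/-- `G′` is symmetric. [cite: Balaban1984PropagatorsII, (2.17) p.225] -/
theorem inner_GpE_left {c : ℝ} (hc : c ≠ 0) {w : SiteIdx D → ℝ} (hw : ∀ i, 0 < w i) (u v : ScalarSpace P) :
    ⟪GpE D hc hw u, v⟫_ℝ = ⟪u, GpE D hc hw v⟫_ℝ := by
  conv_lhs => rw [← deltaPE_GpE D hc hw v]
  conv_rhs => rw [← deltaPE_GpE D hc hw u]
  rw [← inner_deltaPE_left]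

/-- *"G′ = Δ′_a⁻¹ is a well defined, positive operator"*: `⟨u, G′u⟩ > 0` for `u ≠ 0`. [cite: Balaban1984PropagatorsII, (2.17) p.225] -/
theorem inner_GpE_pos {c : ℝ} (hc : c ≠ 0) {w : SiteIdx D → ℝ} (hw : ∀ i, 0 < w i) {u : ScalarSpace P} (hu : u ≠ 0) :
    0 < ⟪u, GpE D hc hw u⟫_ℝ := by
  have hy : GpE D hc hw u ≠ 0 := fun h => hu (by rw [← deltaPE_GpE D hc hw u, h, map_zero])
  have := deltaPE_pos D hc hw hy
  rwa [← inner_deltaPE_left, deltaPE_GpE] at this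

/-- `G′` is injective. [cite: Balaban1984PropagatorsII, (2.17) p.225] -/
theorem GpE_injective {c : ℝ} (hc : c ≠ 0) {w : SiteIdx D → ℝ} (hw : ∀ i, 0 < w i) : Function.Injective (GpE D hc hw) :=
  fun u v h => by rw [← deltaPE_GpE D hc hw u, ← deltaPE_GpE D hc hw v, h]

/-! ## §2. *"G′² and Q′G′²Q′* are positive operators, hence (Q′G′²Q′*)⁻¹ is well defined and positive also"* -/

/-- `⟨u, G′²u⟩ = ‖G′u‖²`. [cite: Balaban1984PropagatorsII, p.225 after (2.17)] -/
theorem inner_GpE_sq {c : ℝ} (hc : c ≠ 0) {w : SiteIdx D → ℝ} (hw : ∀ i, 0 < w i) (u : ScalarSpace P) :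
    ⟪u, GpE D hc hw (GpE D hc hw u)⟫_ℝ = ‖GpE D hc hw u‖ ^ 2 := by
  rw [← inner_GpE_left, real_inner_self_eq_norm_sq]

/-- *"G′² [is a] positive operator"*: `⟨u, G′²u⟩ > 0` for `u ≠ 0`. [cite: Balaban1984PropagatorsII, p.225 after (2.17)] -/
theorem inner_GpE_sq_pos {c : ℝ} (hc : c ≠ 0) {w : SiteIdx D → ℝ} (hw : ∀ i, 0 < w i) {u : ScalarSpace P} (hu : u ≠ 0) :
    0 < ⟪u, GpE D hc hw (GpE D hc hw u)⟫_ℝ := by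
  rw [inner_GpE_sq]
  exact pow_pos (norm_pos_iff.mpr fun h => hu (GpE_injective D hc hw (by rw [h, map_zero]))) 2

/-- **`Q′G′²Q′*`** on `L²(𝔅)`. [cite: Balaban1984PropagatorsII, (2.16)–(2.17) p.225] -/
def qggqpE {c : ℝ} (hc : c ≠ 0) {w : SiteIdx D → ℝ} (hw : ∀ i, 0 < w i) : SiteIdxSpace D →ₗ[ℝ] SiteIdxSpace D :=
  QpE D ∘ₗ (GpE D hc hw ∘ₗ GpE D hc hw) ∘ₗ QpsE D

/-- unfolding. [cite: Balaban1984PropagatorsII, (2.17) p.225] -/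
theorem qggqpE_def {c : ℝ} (hc : c ≠ 0) {w : SiteIdx D → ℝ} (hw : ∀ i, 0 < w i) :
    qggqpE D hc hw = QpE D ∘ₗ (GpE D hc hw ∘ₗ GpE D hc hw) ∘ₗ QpsE D := rfl

/-- `⟨ω, Q′G′²Q′*ω⟩ = ‖G′Q′*ω‖²` (the positivity computation of [4] p. 25, multi-level). [cite: Balaban1984PropagatorsII, p.225 after (2.17)] -/
theorem inner_qggqpE_self {c : ℝ} (hc : c ≠ 0) {w : SiteIdx D → ℝ} (hw : ∀ i, 0 < w i) (ω : SiteIdxSpace D) :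
    ⟪ω, qggqpE D hc hw ω⟫_ℝ = ‖GpE D hc hw (QpsE D ω)‖ ^ 2 := by
  rw [qggqpE, LinearMap.comp_apply, LinearMap.comp_apply, LinearMap.comp_apply, ← inner_QpsE_left, inner_GpE_sq]

/-- `Q′G′²Q′*` is symmetric. [cite: Balaban1984PropagatorsII, p.225 after (2.17)] -/
theorem inner_qggqpE_left {c : ℝ} (hc : c ≠ 0) {w : SiteIdx D → ℝ} (hw : ∀ i, 0 < w i) (ω ω' : SiteIdxSpace D) :
    ⟪qggqpE D hc hw ω, ω'⟫_ℝ = ⟪ω, qggqpE D hc hw ω'⟫_ℝ := by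
  simp only [qggqpE, LinearMap.comp_apply]
  rw [real_inner_comm ω' (QpE D _), ← inner_QpsE_left D ω', ← inner_GpE_left, ← inner_GpE_left,
    real_inner_comm (QpsE D ω), inner_QpsE_left]

/-- *"Q′G′²Q′* [is a] positive operator"*: `⟨ω, Q′G′²Q′*ω⟩ > 0` for `ω ≠ 0` (`Q′*` injective because `Q′` is onto, gen 5).
[cite: Balaban1984PropagatorsII, p.225 after (2.17)] -/
theorem inner_qggqpE_pos {c : ℝ} (hc : c ≠ 0) {w : SiteIdx D → ℝ} (hw : ∀ i, 0 < w i) {ω : SiteIdxSpace D} (hω : ω ≠ 0) :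
    0 < ⟪ω, qggqpE D hc hw ω⟫_ℝ := by
  rw [inner_qggqpE_self]
  refine pow_pos (norm_pos_iff.mpr fun h => hω ?_) 2
  have h0 : QpsE D ω = 0 := GpE_injective D hc hw (by rw [h, map_zero])
  exact QpsE_injective D (by rw [h0, map_zero])

/-- `Q′G′²Q′*` is injective. [cite: Balaban1984PropagatorsII, p.225 after (2.17)] -/
theorem qggqpE_injective {c : ℝ} (hc : c ≠ 0) {w : SiteIdx D → ℝ} (hw : ∀ i, 0 < w i) :
    Function.Injective (qggqpE D hc hw) :=
  (injective_iff_map_eq_zero _).mpr fun ω hω => by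
    by_contra hne
    have := inner_qggqpE_pos D hc hw hne
    rw [hω, inner_zero_right] at this
    exact lt_irrefl 0 this

/-- **`(Q′G′²Q′*)⁻¹`** (*"hence (Q′G′²Q′*)⁻¹ is well defined"*), the inverse of the injective endomorphism `Q′G′²Q′*` of the
finite-dimensional `L²(𝔅)`. [cite: Balaban1984PropagatorsII, (2.17) p.225] -/
def CpE {c : ℝ} (hc : c ≠ 0) {w : SiteIdx D → ℝ} (hw : ∀ i, 0 < w i) : SiteIdxSpace D →ₗ[ℝ] SiteIdxSpace D :=
  ((LinearEquiv.ofInjectiveEndo (qggqpE D hc hw) (qggqpE_injective D hc hw)).symm : SiteIdxSpace D →ₗ[ℝ] SiteIdxSpace D)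

/-- `(Q′G′²Q′*)((Q′G′²Q′*)⁻¹φ) = φ`. [cite: Balaban1984PropagatorsII, (2.17) p.225] -/
@[simp] theorem qggqpE_CpE {c : ℝ} (hc : c ≠ 0) {w : SiteIdx D → ℝ} (hw : ∀ i, 0 < w i) (φ : SiteIdxSpace D) :
    qggqpE D hc hw (CpE D hc hw φ) = φ :=
  (LinearEquiv.ofInjectiveEndo _ (qggqpE_injective D hc hw)).apply_symm_apply φ

/-- `(Q′G′²Q′*)⁻¹((Q′G′²Q′*)φ) = φ`. [cite: Balaban1984PropagatorsII, (2.17) p.225] -/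
@[simp] theorem CpE_qggqpE {c : ℝ} (hc : c ≠ 0) {w : SiteIdx D → ℝ} (hw : ∀ i, 0 < w i) (φ : SiteIdxSpace D) :
    CpE D hc hw (qggqpE D hc hw φ) = φ :=
  (LinearEquiv.ofInjectiveEndo _ (qggqpE_injective D hc hw)).symm_apply_apply φ

/-- `(Q′G′²Q′*) ∘ (Q′G′²Q′*)⁻¹ = 1` (hypothesis `hE1` of `…B6SectA`). [cite: Balaban1984PropagatorsII, (2.17) p.225] -/
theorem qggqpE_comp_CpE {c : ℝ} (hc : c ≠ 0) {w : SiteIdx D → ℝ} (hw : ∀ i, 0 < w i) :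
    (QpE D ∘ₗ (GpE D hc hw ∘ₗ GpE D hc hw) ∘ₗ QpsE D) ∘ₗ CpE D hc hw = LinearMap.id :=
  LinearMap.ext (qggqpE_CpE D hc hw)

/-- `(Q′G′²Q′*)⁻¹ ∘ (Q′G′²Q′*) = 1` (hypothesis `hE2` of `…B6SectA`). [cite: Balaban1984PropagatorsII, (2.27) p.227] -/
theorem CpE_comp_qggqpE {c : ℝ} (hc : c ≠ 0) {w : SiteIdx D → ℝ} (hw : ∀ i, 0 < w i) :
    CpE D hc hw ∘ₗ (QpE D ∘ₗ (GpE D hc hw ∘ₗ GpE D hc hw) ∘ₗ QpsE D) = LinearMap.id :=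
  LinearMap.ext (CpE_qggqpE D hc hw)

/-- `(Q′G′²Q′*)⁻¹` is symmetric. [cite: Balaban1984PropagatorsII, p.225 after (2.17)] -/
theorem inner_CpE_left {c : ℝ} (hc : c ≠ 0) {w : SiteIdx D → ℝ} (hw : ∀ i, 0 < w i) (φ ψ : SiteIdxSpace D) :
    ⟪CpE D hc hw φ, ψ⟫_ℝ = ⟪φ, CpE D hc hw ψ⟫_ℝ := by
  conv_lhs => rw [← qggqpE_CpE D hc hw ψ]
  rw [← inner_qggqpE_left, qggqpE_CpE]

/-- *"… and positive also"*: `⟨φ, (Q′G′²Q′*)⁻¹φ⟩ > 0` for `φ ≠ 0`. [cite: Balaban1984PropagatorsII, p.225 after (2.17)] -/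
theorem inner_CpE_pos {c : ℝ} (hc : c ≠ 0) {w : SiteIdx D → ℝ} (hw : ∀ i, 0 < w i) {φ : SiteIdxSpace D} (hφ : φ ≠ 0) :
    0 < ⟪φ, CpE D hc hw φ⟫_ℝ := by
  have hne : CpE D hc hw φ ≠ 0 := fun h => hφ (by rw [← qggqpE_CpE D hc hw φ, h, map_zero])
  have hpos := inner_qggqpE_pos D hc hw hne
  rwa [qggqpE_CpE, real_inner_comm] at hpos

end

end Literature.MathematicalPhysics.QuantumFieldTheory.Balaban1983to89.B6SectAScalarModelV1
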